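import Mathlib.Analysis.InnerProductSpace.Rayleigh
import Mathlib.Analysis.Calculus.Deriv.Add
import Mathlib.Analysis.Calculus.Deriv.Comp
import Mathlib.Analysis.SpecialFunctions.Log.Deriv
import Literature.Analysis.OperatorTheory.DiagonalCongruenceNormConvex
import Literature.Analysis.OperatorTheory.PositivityImprovingSpectralGap
import Literature.Analysis.OperatorTheory.ApproxEigenvectorHellmannFeynman
import HarnessLib

/-!
# The top eigenvalue of a differentiable family of positive operators is differentiable at a
# spectral gap, with the Hellmann–Feynman derivative (Kato II-§5.4 Thm 5.4 / VIII-§2.3 Thm 2.6, `m = 1`)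

Analysis/OperatorTheory proofs-layer file (theorems only; no definition, no named fact). Companion of
`DiagonalCongruenceNormConvex.lean` §2 (`norm_secant_bracket`, `hasDerivAt_norm_eq_hellmannFeynman`:
"WHEN the norm is differentiable, its derivative is the Hellmann–Feynman value") and of
`PositiveKernelNormLogConvex.lean` §2 (`log_norm_secant_bracket`): those files bracket the
Hellmann–Feynman VALUE `⟪ψ, T′ψ⟫` of a normalised top vector between secant slopes WITHOUT knowing that
`t ↦ ‖T t‖` is differentiable. This file supplies the missing differentiability under a spectral gap,
by an elementary variational (Kato-free, resolvent-free) argument on a real inner product space `H`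
(completeness is not used):

* §1 `inner_add_apply_self_le_of_gap` — **second-order perturbation bound for the top of the spectrum.**
  `A` symmetric, `ψ` a unit vector with `Aψ = λ₀ψ` and a GAP on `ψ^⊥` in quadratic-form sense
  (`⟪w, Aw⟫ ≤ θ‖w‖²` for `w ⊥ ψ`, `θ < λ₀`), `D` any bounded operator with `‖D‖ ≤ (λ₀-θ)/4`. Then
  `⟪φ, (A+D)φ⟫ ≤ (λ₀ + ⟪ψ, Dψ⟫ + 2‖D‖²/(λ₀-θ)) ‖φ‖²` for every `φ` (write `φ = cψ + w`; the loss
  `-(λ₀-θ)‖w‖²` absorbs the cross terms `2|c|‖w‖‖D‖`). Consequences: `opNorm_le_of_inner_apply_self_le`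
  (symmetric `T ⪰ 0` with `⟪x,Tx⟫ ≤ M‖x‖²` has `‖T‖ ≤ M`, from Mathlib's
  `ContinuousLinearMap.norm_eq_iSup_rayleighQuotient`), `opNorm_eq_of_gap` (`‖A‖ = λ₀` for `A ⪰ 0`),
  `opNorm_add_le_of_gap` / `abs_opNorm_add_sub_le_of_gap`
  (`|‖A+D‖ - (λ₀ + ⟪ψ,Dψ⟫)| ≤ 2‖D‖²/(λ₀-θ)` when `A + D` is symmetric `⪰ 0`).
* §2 `hasDerivAt_opNorm_of_gap` — **the theorem.** `T : ℝ → (H →L[ℝ] H)` with `HasDerivAt T T′ β`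
  (operator norm), `T t` symmetric and `⪰ 0` for `t` near `β`, `ψ` a unit vector with `T β ψ = λ₀ψ` and
  the gap `⟪w, T β w⟫ ≤ θ‖w‖²` (`w ⊥ ψ`, `θ < λ₀`). Then `t ↦ ‖T t‖` HAS A DERIVATIVE at `β`, equal to the
  Hellmann–Feynman value `⟪ψ, T′ψ⟫` (squeeze: `⟪ψ, T t ψ⟫ ≤ ‖T t‖ ≤ ⟪ψ, T t ψ⟫ + 2‖T t - T β‖²/(λ₀-θ)`
  and `‖T t - T β‖ = O(|t-β|)`); `hasDerivAt_log_opNorm_of_gap` (`d/dt log ‖T t‖ = ⟪ψ,T′ψ⟫/λ₀`).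
* §3 — **the brackets now enclose the derivative itself**: with the convexity premise of the secant
  certificates, `hasDerivAt_log_opNorm_mem_secant_of_gap` / `hasDerivAt_opNorm_mem_secant_of_gap`:
  `∂_β log ‖T_β‖` EXISTS, equals `⟪ψ,T′ψ⟫/‖T β‖`, and lies between the two chords.
* §4 — gap in norm form (`‖(T β) w‖ ≤ θ‖w‖` on `ψ^⊥`, the shape of the tree's Jentzsch theorem
  `IsPositivityImproving.exists_spectralGap`) implies the quadratic-form gap
  (`inner_apply_self_le_of_norm_apply_le`); hence `IsPositivityImproving.exists_hasDerivAt_opNorm`: for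
  a family of self-adjoint positive operators on a real `L²(μ)`, differentiable at `β` in operator norm,
  whose member at `β` is non-zero, compact and positivity improving, `t ↦ ‖T t‖` is differentiable at
  `β` with derivative `⟪φ, T′φ⟫`, `φ` the (unit, a.e. positive) Perron–Jentzsch vector of `T β`.
* §5 — **certified numerics**: with a unit APPROXIMATE top vector `v` (residual `‖T β v - m v‖ ≤ ρ`,
  shift `m > θ`) the computable number `⟪v, T′v⟫` encloses THE DERIVATIVE:
  `|⟪v, T′v⟫ - d‖T t‖/dt|_β| ≤ 2‖T′‖(δ + δ²)`, `δ = ρ/(m - θ)` (`abs_inner_sub_deriv_opNorm_le_of_gap`,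
  from `ApproxEigenvectorHellmannFeynman.abs_inner_sub_hellmannFeynman_le`), and the log form.

Printed statements this is the `m = 1`, top-of-the-spectrum, real-Hilbert-space case of: Kato,
II-§5.4 Theorem 5.4 (5.10) (finite dimension: `T(ϰ)` differentiable at `ϰ = 0`, `λ` semisimple ⟹ the
`λ`-group eigenvalues are differentiable at `0` with derivatives the eigenvalues of `P T′(0) P`), and
VIII-§2.3 Theorem 2.6 (2.17) (isolated semisimple eigenvalue of finite multiplicity `m`, asymptotic
expansion `μ_j(ϰ) = λ + ϰ μ_j⁽¹⁾ + o(ϰ)`; for `m = 1` and `T′` symmetric, `μ⁽¹⁾ = ⟪φ, T′φ⟫`); matrix case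
Horn–Johnson Thm. 6.3.12 (c) (`dλ/dt|₀ = y^*Ex/(y^*x)` for a simple eigenvalue of `A + tE`). The proof
here is not Kato's (no resolvents, no reduction to the `λ`-group): it is the variational squeeze above.

Application (cell `pub-ymgap`, track Y3, by dictionary only; nothing about lattice gauge theory is
formalised here): the FLOW-TABLE «SECANT-CONVEX» / «O7 secant recipe» rows speak of "the β-derivative
of `ln λ̂₀`"; with this file that derivative EXISTS (object W: Jentzsch gap of the compact, positive,
positivity improving transfer operator, `isPositivityImproving_wilsonTorusTransferMatrix` & co.; object
W_S: a certified gap of the truncated matrix) and the existing brackets enclose it — provided the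
operator family is differentiable in operator norm at `β` (for kernel families: a dominated derivative
kernel; for matrix families: entrywise differentiability), which is the instance-level input.

## Mathlib / tree search

Mathlib: `ContinuousLinearMap.norm_eq_iSup_rayleighQuotient` (symmetric ⟹ `‖T‖ = sup |Rayleigh|`),
`HasDerivAt.isBigO_sub`, `Asymptotics.isLittleO_pow_sub_sub`, `HasDerivAt.log`; no statement on the
differentiability of `‖T t‖` / of an extremal eigenvalue of an operator family
(`lean search 'hasDerivAt_(opNorm|norm_of|eigenvalue)'`: none). Tree: Kato II-(2.36) for HOLOMORPHIC
complex families (`SimpleEigenvalueDerivative`, needs the Riesz projection branch); linear hermitean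
pencils at generic points (`Literature/Analysis/Matrix/EigenvalueBranches`); the touching lemma and
brackets cited above; the Jentzsch gap `PositivityImprovingSpectralGap`.

## References

* T. Kato, *Perturbation Theory for Linear Operators*, Springer 1966: II-§5.4 Theorem 5.4 with (5.9),
  (5.10) and Remark 5.5 (held copy chunk p0146); VIII-§2.3 Theorem 2.6 with (2.17)–(2.19) (chunks
  p0515–p0516). [Kato1966]
* R. A. Horn, C. R. Johnson, *Matrix Analysis*, 2nd ed., CUP 2013, Thm. 6.3.12 (held copy chunk
  p0506). [HornJohnson2013]
* M. Reed, B. Simon, *Methods of Modern Mathematical Physics IV*, Thms XIII.43–44 (Jentzsch /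
  nondegenerate ground state; used through `PositivityImprovingSpectralGap`). [ReedSimonIV1978]
-/

noncomputable section

open Set Filter Topology Asymptotics
open scoped RealInnerProductSpace

namespace Literature.Analysis.OperatorTheory

/-! ## 1. Second-order perturbation bound for the top of the spectrum at a gap -/

section Static

variable {H : Type*} [NormedAddCommGroup H] [InnerProductSpace ℝ H]

/-- **Second-order perturbation bound for the top of the spectrum at a spectral gap.** Let `A` be a
bounded symmetric operator on a real inner product space, `ψ` a unit vector with `A ψ = λ₀ ψ`, and
suppose `A` has a gap below `λ₀` on `ψ^⊥` in quadratic-form sense: `⟪w, A w⟫ ≤ θ ‖w‖²` whenever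
`⟪ψ, w⟫ = 0`, with `θ < λ₀`. Then for every bounded `D` with `‖D‖ ≤ (λ₀ - θ)/4` and every `φ`,
`⟪φ, (A + D) φ⟫ ≤ (λ₀ + ⟪ψ, D ψ⟫ + 2‖D‖²/(λ₀ - θ)) ‖φ‖²` — the numerical range of `A + D` exceeds the
first-order value `λ₀ + ⟪ψ, Dψ⟫` by at most `2‖D‖²/(λ₀-θ)`. (Write `φ = cψ + w`, `w ⊥ ψ`: the `A`-part
is `c²λ₀ + ⟪w,Aw⟫ ≤ c²λ₀ + θ‖w‖²`, the `D`-part is at most `c²⟪ψ,Dψ⟫ + 2|c|‖w‖‖D‖ + ‖w‖²‖D‖`, and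
`(λ₀-θ)‖w‖²/2 + 2‖D‖²c²/(λ₀-θ) ≥ 2|c|‖w‖‖D‖`.) This is the quantitative form of the first-order
expansion `μ(ϰ) = λ + ϰ μ⁽¹⁾ + o(ϰ)` of an isolated simple eigenvalue, for the top of the spectrum.
[cite: Kato1966, VIII-§2.3 Theorem 2.6 (2.17) (case m = 1); II-§5.4 Theorem 5.4 (5.10)] -/
theorem inner_add_apply_self_le_of_gap (A D : H →L[ℝ] H) (hA : (A : H →ₗ[ℝ] H).IsSymmetric)
    {ψ : H} (hψ : ‖ψ‖ = 1) {Λ₀ θ : ℝ} (heig : A ψ = Λ₀ • ψ) (hθ : θ < Λ₀)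
    (hgap : ∀ w : H, ⟪ψ, w⟫ = 0 → ⟪w, A w⟫ ≤ θ * ‖w‖ ^ 2) (hD : ‖D‖ ≤ (Λ₀ - θ) / 4) (φ : H) :
    ⟪φ, (A + D) φ⟫ ≤ (Λ₀ + ⟪ψ, D ψ⟫ + 2 * ‖D‖ ^ 2 / (Λ₀ - θ)) * ‖φ‖ ^ 2 := by
  -- decompose `φ = c • ψ + w` with `w ⊥ ψ`
  have hψψ : ⟪ψ, ψ⟫ = 1 := by rw [real_inner_self_eq_norm_sq, hψ, one_pow]
  obtain ⟨c, w, rfl, hw⟩ : ∃ (c : ℝ) (w : H), φ = c • ψ + w ∧ ⟪ψ, w⟫ = 0 :=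
    ⟨⟪ψ, φ⟫, φ - ⟪ψ, φ⟫ • ψ, by rw [add_sub_cancel],
      by rw [inner_sub_right, real_inner_smul_right, hψψ, mul_one, sub_self]⟩
  -- `θ = Λ₀ - δ` with `δ > 0`
  obtain ⟨δ, hδ, rfl⟩ : ∃ δ : ℝ, 0 < δ ∧ θ = Λ₀ - δ := ⟨Λ₀ - θ, sub_pos.2 hθ, (sub_sub_cancel _ _).symm⟩
  have hδ' : Λ₀ - (Λ₀ - δ) = δ := sub_sub_cancel Λ₀ δ
  rw [hδ'] at hD ⊢
  -- abbreviations (as plain facts; `K = ‖D‖`, `s = ‖w‖`, `u = |c|`)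
  have hK : 0 ≤ ‖D‖ := norm_nonneg _
  have h4K : 4 * ‖D‖ ≤ δ := by
    have := hD; rw [le_div_iff₀ (by norm_num : (0:ℝ) < 4)] at this; linarith
  have hs : 0 ≤ ‖w‖ := norm_nonneg _
  have hu : 0 ≤ |c| := abs_nonneg _
  have hu2 : |c| ^ 2 = c ^ 2 := sq_abs c
  -- the norm of `φ`
  have hwψ : ⟪w, ψ⟫ = 0 := by rw [real_inner_comm]; exact hw
  have hnorm : ‖c • ψ + w‖ ^ 2 = c ^ 2 + ‖w‖ ^ 2 := by
    have horth : ⟪c • ψ, w⟫ = 0 := by rw [real_inner_smul_left, hw, mul_zero]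
    have h1 : ‖c • ψ + w‖ * ‖c • ψ + w‖ = ‖c • ψ‖ * ‖c • ψ‖ + ‖w‖ * ‖w‖ :=
      norm_add_sq_eq_norm_sq_add_norm_sq_real horth
    have h2 : ‖c • ψ‖ = |c| := by rw [norm_smul, hψ, mul_one, Real.norm_eq_abs]
    rw [sq, h1, h2, ← hu2]
    ring
  -- the `A`-part
  have hAψ : ⟪ψ, A ψ⟫ = Λ₀ := by rw [heig, real_inner_smul_right, hψψ, mul_one]
  have hψAw : ⟪ψ, A w⟫ = 0 := by
    rw [← hA.apply_clm, heig, real_inner_smul_left, hw, mul_zero]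
  have hwAψ : ⟪w, A ψ⟫ = 0 := by rw [heig, real_inner_smul_right, hwψ, mul_zero]
  have ha : ⟪w, A w⟫ ≤ (Λ₀ - δ) * ‖w‖ ^ 2 := hgap w hw
  -- the `D`-part: bounds on the four matrix elements
  have hp : -‖D‖ ≤ ⟪ψ, D ψ⟫ := by
    have h1 : |⟪ψ, D ψ⟫| ≤ ‖ψ‖ * ‖D ψ‖ := abs_real_inner_le_norm _ _
    have h2 : ‖D ψ‖ ≤ ‖D‖ * ‖ψ‖ := D.le_opNorm ψ
    rw [hψ, one_mul] at h1; rw [hψ, mul_one] at h2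
    have := neg_abs_le ⟪ψ, D ψ⟫
    linarith
  have hx1 : c * ⟪ψ, D w⟫ ≤ |c| * (‖D‖ * ‖w‖) := by
    have h1 : |⟪ψ, D w⟫| ≤ ‖ψ‖ * ‖D w‖ := abs_real_inner_le_norm _ _
    rw [hψ, one_mul] at h1
    have h2 : ‖D w‖ ≤ ‖D‖ * ‖w‖ := D.le_opNorm w
    calc c * ⟪ψ, D w⟫ ≤ |c * ⟪ψ, D w⟫| := le_abs_self _
      _ = |c| * |⟪ψ, D w⟫| := by rw [abs_mul]
      _ ≤ |c| * (‖D‖ * ‖w‖) := mul_le_mul_of_nonneg_left (h1.trans h2) hu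
  have hx2 : c * ⟪w, D ψ⟫ ≤ |c| * (‖D‖ * ‖w‖) := by
    have h1 : |⟪w, D ψ⟫| ≤ ‖w‖ * ‖D ψ‖ := abs_real_inner_le_norm _ _
    have h2 : ‖D ψ‖ ≤ ‖D‖ * ‖ψ‖ := D.le_opNorm ψ
    rw [hψ, mul_one] at h2
    have h3 : |⟪w, D ψ⟫| ≤ ‖D‖ * ‖w‖ :=
      h1.trans (by rw [mul_comm]; exact mul_le_mul_of_nonneg_right h2 hs)
    calc c * ⟪w, D ψ⟫ ≤ |c * ⟪w, D ψ⟫| := le_abs_self _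
      _ = |c| * |⟪w, D ψ⟫| := by rw [abs_mul]
      _ ≤ |c| * (‖D‖ * ‖w‖) := mul_le_mul_of_nonneg_left h3 hu
  have hx3 : ⟪w, D w⟫ ≤ ‖D‖ * ‖w‖ ^ 2 := by
    calc ⟪w, D w⟫ ≤ ‖w‖ * ‖D w‖ := real_inner_le_norm _ _
      _ ≤ ‖w‖ * (‖D‖ * ‖w‖) := mul_le_mul_of_nonneg_left (D.le_opNorm w) (norm_nonneg _)
      _ = ‖D‖ * ‖w‖ ^ 2 := by ring
  -- expand the quadratic form
  have hexp : ⟪c • ψ + w, (A + D) (c • ψ + w)⟫ =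
      c ^ 2 * Λ₀ + ⟪w, A w⟫ + (c ^ 2 * ⟪ψ, D ψ⟫ + c * ⟪ψ, D w⟫ + c * ⟪w, D ψ⟫ + ⟪w, D w⟫) := by
    simp only [add_apply, map_add, map_smul, inner_add_left, inner_add_right,
      real_inner_smul_left, real_inner_smul_right, hAψ, hψAw, hwAψ]
    ring
  rw [hexp, hnorm]
  -- first-order collection of the bounds
  have hlin : c ^ 2 * Λ₀ + ⟪w, A w⟫ + (c ^ 2 * ⟪ψ, D ψ⟫ + c * ⟪ψ, D w⟫ + c * ⟪w, D ψ⟫ + ⟪w, D w⟫)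
      ≤ c ^ 2 * Λ₀ + (Λ₀ - δ) * ‖w‖ ^ 2 + c ^ 2 * ⟪ψ, D ψ⟫ + 2 * |c| * (‖D‖ * ‖w‖)
        + ‖D‖ * ‖w‖ ^ 2 := by
    linarith
  refine hlin.trans ?_
  -- clear the denominator `δ`
  rw [show (Λ₀ + ⟪ψ, D ψ⟫ + 2 * ‖D‖ ^ 2 / δ) * (c ^ 2 + ‖w‖ ^ 2) =
      ((Λ₀ + ⟪ψ, D ψ⟫) * δ + 2 * ‖D‖ ^ 2) * (c ^ 2 + ‖w‖ ^ 2) / δ by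
    field_simp]
  rw [le_div_iff₀ hδ]
  -- the polynomial inequality
  nlinarith [sq_nonneg (δ * ‖w‖ - 2 * ‖D‖ * |c|), hu2,
    mul_nonneg (mul_nonneg hδ.le (sq_nonneg ‖w‖)) (show 0 ≤ ⟪ψ, D ψ⟫ + ‖D‖ by linarith),
    mul_nonneg (mul_nonneg hδ.le (sq_nonneg ‖w‖)) (show 0 ≤ δ - 4 * ‖D‖ by linarith),
    mul_nonneg (sq_nonneg ‖D‖) (sq_nonneg ‖w‖), mul_nonneg hu (mul_nonneg hK hs)]

/-- **A symmetric positive operator whose quadratic form is bounded by `M ‖x‖²` has norm at most `M`**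
(`‖T‖ = sup_{x ≠ 0} |⟪Tx, x⟫|/‖x‖²` for symmetric `T`, Mathlib's
`ContinuousLinearMap.norm_eq_iSup_rayleighQuotient`, and `⟪Tx,x⟫ ≥ 0`; Kato's (6.33):
`|t[u,v]| ≤ max(|γ|,|γ′|) ‖u‖‖v‖` with `γ ≤ γ′` the lower/upper bounds of the symmetric form, valid
for bounded forms on a Hilbert space by V-§2.1). [cite: Kato1966, I-§6.5 (6.33) with V-§2.1] -/
theorem opNorm_le_of_inner_apply_self_le {T : H →L[ℝ] H} (hT : (T : H →ₗ[ℝ] H).IsSymmetric)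
    (hpsd : ∀ x : H, 0 ≤ ⟪x, T x⟫) {M : ℝ} (hM : 0 ≤ M) (h : ∀ x : H, ⟪x, T x⟫ ≤ M * ‖x‖ ^ 2) :
    ‖T‖ ≤ M := by
  rw [T.norm_eq_iSup_rayleighQuotient hT]
  refine ciSup_le fun x => ?_
  rw [ContinuousLinearMap.rayleighQuotient, ContinuousLinearMap.reApplyInnerSelf_apply,
    RCLike.re_to_real, real_inner_comm]
  by_cases hx : x = 0
  · simp [hx, hM]
  · have hx2 : 0 < ‖x‖ ^ 2 := by positivity
    rw [abs_of_nonneg (div_nonneg (hpsd x) hx2.le), div_le_iff₀ hx2]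
    exact h x

/-- **At a spectral gap the norm of a symmetric positive operator is the top eigenvalue**: `A` symmetric
with `⟪x, Ax⟫ ≥ 0`, `Aψ = λ₀ψ` (`‖ψ‖ = 1`) and `⟪w,Aw⟫ ≤ θ‖w‖²` on `ψ^⊥` with `θ < λ₀` give `‖A‖ = λ₀`.
[cite: Kato1966, I-§6.5 (6.33) with V-§2.1] -/
theorem opNorm_eq_of_gap (A : H →L[ℝ] H) (hA : (A : H →ₗ[ℝ] H).IsSymmetric)
    (hpsd : ∀ x : H, 0 ≤ ⟪x, A x⟫) {ψ : H} (hψ : ‖ψ‖ = 1) {Λ₀ θ : ℝ} (heig : A ψ = Λ₀ • ψ)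
    (hθ : θ < Λ₀) (hgap : ∀ w : H, ⟪ψ, w⟫ = 0 → ⟪w, A w⟫ ≤ θ * ‖w‖ ^ 2) : ‖A‖ = Λ₀ := by
  have hψψ : ⟪ψ, ψ⟫ = 1 := by rw [real_inner_self_eq_norm_sq, hψ, one_pow]
  have hAψ : ⟪ψ, A ψ⟫ = Λ₀ := by rw [heig, real_inner_smul_right, hψψ, mul_one]
  have hlow : Λ₀ ≤ ‖A‖ := hAψ ▸ real_inner_apply_le_opNorm A hψ
  have hnn : 0 ≤ Λ₀ := hAψ ▸ hpsd ψ
  refine le_antisymm ?_ hlow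
  refine opNorm_le_of_inner_apply_self_le hA hpsd hnn fun x => ?_
  have key := inner_add_apply_self_le_of_gap A 0 hA hψ heig hθ hgap
    (by rw [norm_zero]; linarith [sub_pos.2 hθ]) x
  simpa using key

/-- **First-order perturbation of the top eigenvalue with explicit second-order remainder, upper half.**
In the setting of `inner_add_apply_self_le_of_gap`, if moreover `A + D` is symmetric and positive
(`⟪x, (A+D)x⟫ ≥ 0`), then `‖A + D‖ ≤ λ₀ + ⟪ψ, Dψ⟫ + 2‖D‖²/(λ₀ - θ)`.
[cite: Kato1966, VIII-§2.3 Theorem 2.6 (2.17) (case m = 1)] -/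
theorem opNorm_add_le_of_gap (A D : H →L[ℝ] H) (hA : (A : H →ₗ[ℝ] H).IsSymmetric)
    (hAD : ((A + D : H →L[ℝ] H) : H →ₗ[ℝ] H).IsSymmetric) (hpsd : ∀ x : H, 0 ≤ ⟪x, (A + D) x⟫)
    {ψ : H} (hψ : ‖ψ‖ = 1) {Λ₀ θ : ℝ} (heig : A ψ = Λ₀ • ψ) (hθ : θ < Λ₀)
    (hgap : ∀ w : H, ⟪ψ, w⟫ = 0 → ⟪w, A w⟫ ≤ θ * ‖w‖ ^ 2) (hD : ‖D‖ ≤ (Λ₀ - θ) / 4) :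
    ‖A + D‖ ≤ Λ₀ + ⟪ψ, D ψ⟫ + 2 * ‖D‖ ^ 2 / (Λ₀ - θ) := by
  have hψψ : ⟪ψ, ψ⟫ = 1 := by rw [real_inner_self_eq_norm_sq, hψ, one_pow]
  have hAψ : ⟪ψ, A ψ⟫ = Λ₀ := by rw [heig, real_inner_smul_right, hψψ, mul_one]
  -- `M ≥ 0`: `Λ₀ + ⟪ψ,Dψ⟫ = ⟪ψ,(A+D)ψ⟫ ≥ 0`
  have hM : 0 ≤ Λ₀ + ⟪ψ, D ψ⟫ + 2 * ‖D‖ ^ 2 / (Λ₀ - θ) := by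
    have h1 : 0 ≤ Λ₀ + ⟪ψ, D ψ⟫ := by
      have := hpsd ψ
      rwa [add_apply, inner_add_right, hAψ] at this
    have h2 : 0 ≤ 2 * ‖D‖ ^ 2 / (Λ₀ - θ) := div_nonneg (by positivity) (sub_pos.2 hθ).le
    linarith
  exact opNorm_le_of_inner_apply_self_le hAD hpsd hM (inner_add_apply_self_le_of_gap A D hA hψ heig hθ hgap hD)

/-- **First-order perturbation of the top eigenvalue with explicit second-order remainder.** In the
setting of `opNorm_add_le_of_gap`: `|‖A + D‖ - (λ₀ + ⟪ψ, Dψ⟫)| ≤ 2‖D‖²/(λ₀ - θ)` (the lower half is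
`⟪ψ, (A+D)ψ⟫ ≤ ‖A+D‖`). With `D = ϰ T⁽¹⁾` this is `λ(ϰ) = λ + ϰ ⟪ψ, T⁽¹⁾ψ⟫ + O(ϰ²)` for the top
eigenvalue `λ(ϰ) = ‖A + ϰT⁽¹⁾‖`. [cite: Kato1966, VIII-§2.3 Theorem 2.6 (2.17) (case m = 1)] -/
theorem abs_opNorm_add_sub_le_of_gap (A D : H →L[ℝ] H) (hA : (A : H →ₗ[ℝ] H).IsSymmetric)
    (hAD : ((A + D : H →L[ℝ] H) : H →ₗ[ℝ] H).IsSymmetric) (hpsd : ∀ x : H, 0 ≤ ⟪x, (A + D) x⟫)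
    {ψ : H} (hψ : ‖ψ‖ = 1) {Λ₀ θ : ℝ} (heig : A ψ = Λ₀ • ψ) (hθ : θ < Λ₀)
    (hgap : ∀ w : H, ⟪ψ, w⟫ = 0 → ⟪w, A w⟫ ≤ θ * ‖w‖ ^ 2) (hD : ‖D‖ ≤ (Λ₀ - θ) / 4) :
    |‖A + D‖ - (Λ₀ + ⟪ψ, D ψ⟫)| ≤ 2 * ‖D‖ ^ 2 / (Λ₀ - θ) := by
  have hψψ : ⟪ψ, ψ⟫ = 1 := by rw [real_inner_self_eq_norm_sq, hψ, one_pow]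
  have hAψ : ⟪ψ, A ψ⟫ = Λ₀ := by rw [heig, real_inner_smul_right, hψψ, mul_one]
  have hup := opNorm_add_le_of_gap A D hA hAD hpsd hψ heig hθ hgap hD
  have hlow : Λ₀ + ⟪ψ, D ψ⟫ ≤ ‖A + D‖ := by
    have := real_inner_apply_le_opNorm (A + D) hψ
    rwa [add_apply, inner_add_right, hAψ] at this
  have h2 : 0 ≤ 2 * ‖D‖ ^ 2 / (Λ₀ - θ) := div_nonneg (by positivity) (sub_pos.2 hθ).le
  rw [abs_le]; constructor <;> linarith

end Static

/-! ## 2. Differentiability of `t ↦ ‖T t‖` at a spectral gap (Hellmann–Feynman) -/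

section Deriv

variable {H : Type*} [NormedAddCommGroup H] [InnerProductSpace ℝ H]

/-- Matrix elements of a differentiable operator family are differentiable:
`d/dt ⟪φ, T t ψ⟫ = ⟪φ, T′ ψ⟫` (chain rule with the bounded linear functional `L ↦ ⟪φ, Lψ⟫`).
[cite: Kato1966, II-§5.4 (5.9)–(5.10) (differentiability at a point, operator-valued o(ϰ))] -/
theorem hasDerivAt_inner_apply (T : ℝ → H →L[ℝ] H) {T' : H →L[ℝ] H} {β : ℝ}
    (hT : HasDerivAt T T' β) (φ ψ : H) :
    HasDerivAt (fun t => ⟪φ, T t ψ⟫) ⟪φ, T' ψ⟫ β := by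
  have hL := ((innerSL ℝ φ).comp (ContinuousLinearMap.apply ℝ H ψ)).hasFDerivAt.comp_hasDerivAt β hT
  simpa [Function.comp_def, innerSL_apply_apply, ContinuousLinearMap.apply_apply] using hL

/-- **The top eigenvalue of a differentiable family of positive symmetric operators is differentiable
at a spectral gap, with the Hellmann–Feynman derivative.** Let `T : ℝ → (H →L[ℝ] H)` have derivative
`T′` at `β` in operator norm; let `T t` be symmetric with `⟪φ, T t φ⟫ ≥ 0` for all `t` near `β`; let
`ψ` be a unit vector with `T β ψ = λ₀ ψ`, and let `T β` have a gap below `λ₀` on `ψ^⊥`: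
`⟪w, T β w⟫ ≤ θ ‖w‖²` for `⟪ψ, w⟫ = 0`, with `θ < λ₀` (so `λ₀ = ‖T β‖` is the simple, isolated top
eigenvalue). Then `t ↦ ‖T t‖` has a derivative at `β`, equal to `⟪ψ, T′ ψ⟫`. Proof: squeeze
`⟪ψ, T t ψ⟫ ≤ ‖T t‖ ≤ ⟪ψ, T t ψ⟫ + 2‖T t - T β‖²/(λ₀ - θ)` (`inner_add_apply_self_le_of_gap` with
`A = T β`, `D = T t - T β`) and `‖T t - T β‖ = O(|t - β|)`. Kato's printed form (`m = 1`):
`λ(ϰ) = λ + ϰ λ⁽¹⁾ + o(ϰ)`, `λ⁽¹⁾ =` the eigenvalue of `P T′ P`, i.e. `⟪ψ, T′ψ⟫`.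
[cite: Kato1966, II-§5.4 Theorem 5.4 (5.10); VIII-§2.3 Theorem 2.6 (2.17) (case m = 1)] -/
theorem hasDerivAt_opNorm_of_gap (T : ℝ → H →L[ℝ] H) {T' : H →L[ℝ] H} {β : ℝ}
    (hT : HasDerivAt T T' β) (hsymm : ∀ᶠ t in 𝓝 β, (T t : H →ₗ[ℝ] H).IsSymmetric)
    (hpsd : ∀ᶠ t in 𝓝 β, ∀ φ : H, 0 ≤ ⟪φ, T t φ⟫) {ψ : H} (hψ : ‖ψ‖ = 1) {Λ₀ θ : ℝ}
    (heig : T β ψ = Λ₀ • ψ) (hθ : θ < Λ₀)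
    (hgap : ∀ w : H, ⟪ψ, w⟫ = 0 → ⟪w, T β w⟫ ≤ θ * ‖w‖ ^ 2) :
    HasDerivAt (fun t => ‖T t‖) ⟪ψ, T' ψ⟫ β := by
  set δ : ℝ := Λ₀ - θ with hδ_def
  have hδ : 0 < δ := sub_pos.2 hθ
  have hψψ : ⟪ψ, ψ⟫ = 1 := by rw [real_inner_self_eq_norm_sq, hψ, one_pow]
  have hsymmβ : (T β : H →ₗ[ℝ] H).IsSymmetric := hsymm.self_of_nhds
  have hpsdβ : ∀ φ : H, 0 ≤ ⟪φ, T β φ⟫ := hpsd.self_of_nhds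
  -- the touching function `g t = ⟪ψ, T t ψ⟫`
  have hg : HasDerivAt (fun t => ⟪ψ, T t ψ⟫) ⟪ψ, T' ψ⟫ β := hasDerivAt_inner_apply T hT ψ ψ
  have hgβ : ⟪ψ, T β ψ⟫ = Λ₀ := by rw [heig, real_inner_smul_right, hψψ, mul_one]
  have hnormβ : ‖T β‖ = Λ₀ := opNorm_eq_of_gap (T β) hsymmβ hpsdβ hψ heig hθ hgap
  -- `‖T t - T β‖ ≤ δ/4` near `β`
  have hsmall : ∀ᶠ t in 𝓝 β, ‖T t - T β‖ ≤ δ / 4 := by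
    have h := Metric.tendsto_nhds.1 hT.continuousAt (δ / 4) (by positivity)
    filter_upwards [h] with t ht
    rw [dist_eq_norm] at ht
    exact ht.le
  -- upper squeeze: `‖T t‖ ≤ ⟪ψ, T t ψ⟫ + 2 ‖T t - T β‖² / δ` near `β`
  have hup : ∀ᶠ t in 𝓝 β, ‖T t‖ ≤ ⟪ψ, T t ψ⟫ + 2 * ‖T t - T β‖ ^ 2 / δ := by
    filter_upwards [hsymm, hpsd, hsmall] with t ht hp hs
    have e : T β + (T t - T β) = T t := add_sub_cancel (T β) (T t)
    have key := opNorm_add_le_of_gap (T β) (T t - T β) hsymmβ (by rw [e]; exact ht)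
      (by rw [e]; exact hp) hψ heig hθ hgap hs
    rw [e] at key
    have e2 : Λ₀ + ⟪ψ, (T t - T β) ψ⟫ = ⟪ψ, T t ψ⟫ := by
      rw [sub_apply, inner_sub_right, hgβ]; ring
    rwa [e2] at key
  -- lower squeeze: `⟪ψ, T t ψ⟫ ≤ ‖T t‖` always
  have hlow : ∀ t, ⟪ψ, T t ψ⟫ ≤ ‖T t‖ := fun t => real_inner_apply_le_opNorm (T t) hψ
  -- `‖T t - T β‖ = O(|t - β|)`
  obtain ⟨C, hC⟩ := hT.isBigO_sub.bound
  -- the remainder `r t = ‖T t‖ - ⟪ψ, T t ψ⟫` has derivative `0` at `β`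
  have hr : HasDerivAt (fun t => ‖T t‖ - ⟪ψ, T t ψ⟫) 0 β := by
    rw [hasDerivAt_iff_isLittleO]
    have hrβ : ‖T β‖ - ⟪ψ, T β ψ⟫ = 0 := by rw [hnormβ, hgβ, sub_self]
    simp only [smul_zero, sub_zero, hrβ]
    refine IsBigO.trans_isLittleO (g := fun t => ‖t - β‖ ^ 2) ?_ (isLittleO_pow_sub_sub β one_lt_two)
    refine IsBigO.of_bound (2 * C ^ 2 / δ) ?_
    filter_upwards [hup, hC] with t h1 h2
    have h0 : 0 ≤ ‖T t‖ - ⟪ψ, T t ψ⟫ := sub_nonneg.2 (hlow t)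
    rw [Real.norm_of_nonneg h0, Real.norm_of_nonneg (by positivity)]
    have h3 : ‖T t - T β‖ ^ 2 ≤ (C * ‖t - β‖) ^ 2 := by
      have hC0 : 0 ≤ C * ‖t - β‖ := (norm_nonneg _).trans h2
      exact pow_le_pow_left₀ (norm_nonneg _) h2 2
    calc ‖T t‖ - ⟪ψ, T t ψ⟫ ≤ 2 * ‖T t - T β‖ ^ 2 / δ := by linarith
      _ ≤ 2 * (C * ‖t - β‖) ^ 2 / δ := by gcongr
      _ = 2 * C ^ 2 / δ * ‖t - β‖ ^ 2 := by ring
  have hsum := hg.add hr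
  rw [add_zero] at hsum
  refine hsum.congr_of_eventuallyEq (Eventually.of_forall fun t => ?_)
  show ‖T t‖ = ⟪ψ, T t ψ⟫ + (‖T t‖ - ⟪ψ, T t ψ⟫)
  ring

/-- **Logarithmic form**: in the setting of `hasDerivAt_opNorm_of_gap` with `λ₀ > 0`,
`t ↦ log ‖T t‖` has derivative `⟪ψ, T′ψ⟫/λ₀` at `β` (the normalised Hellmann–Feynman value, the
quantity enclosed by the «secant» certificates). [cite: Kato1966, II-§5.4 Theorem 5.4 (5.10); VIII-§2.3
Theorem 2.6 (2.17) (case m = 1)] -/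
theorem hasDerivAt_log_opNorm_of_gap (T : ℝ → H →L[ℝ] H) {T' : H →L[ℝ] H} {β : ℝ}
    (hT : HasDerivAt T T' β) (hsymm : ∀ᶠ t in 𝓝 β, (T t : H →ₗ[ℝ] H).IsSymmetric)
    (hpsd : ∀ᶠ t in 𝓝 β, ∀ φ : H, 0 ≤ ⟪φ, T t φ⟫) {ψ : H} (hψ : ‖ψ‖ = 1) {Λ₀ θ : ℝ}
    (heig : T β ψ = Λ₀ • ψ) (hθ : θ < Λ₀) (hpos : 0 < Λ₀)
    (hgap : ∀ w : H, ⟪ψ, w⟫ = 0 → ⟪w, T β w⟫ ≤ θ * ‖w‖ ^ 2) :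
    HasDerivAt (fun t => Real.log ‖T t‖) (⟪ψ, T' ψ⟫ / Λ₀) β := by
  have h := hasDerivAt_opNorm_of_gap T hT hsymm hpsd hψ heig hθ hgap
  have hβ : ‖T β‖ = Λ₀ :=
    opNorm_eq_of_gap (T β) hsymm.self_of_nhds hpsd.self_of_nhds hψ heig hθ hgap
  have := h.log (by rw [hβ]; exact hpos.ne')
  rwa [hβ] at this

end Deriv

/-! ## 3. With the convexity premise, the secant brackets enclose THE DERIVATIVE -/

section Bracket

variable {H : Type*} [NormedAddCommGroup H] [InnerProductSpace ℝ H]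

/-- **The derivative of `log ‖T ·‖` exists and lies in the secant bracket.** In the setting of
`hasDerivAt_opNorm_of_gap` (gap at `β`, `λ₀ > 0`), if moreover `t ↦ log ‖T t‖` is convex on
`[β - h, β + h]` (`h > 0`; e.g. Kingman log-convexity for positive-kernel families), then
`F = log ‖T ·‖` is differentiable at `β`, `F′(β) = ⟪ψ, T′ψ⟫/‖T β‖`, and
`(F β - F (β-h))/h ≤ F′(β) ≤ (F (β+h) - F β)/h` (`log_norm_secant_bracket`). So a certified enclosure of
the two chords encloses the DERIVATIVE of `log λ₀`, not only the Hellmann–Feynman value.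
[cite: Kato1966, II-§5.4 Theorem 5.4 (5.10) (with Dudley2002 §6.3 Cor. 6.3.3 for the chords)] -/
theorem hasDerivAt_log_opNorm_mem_secant_of_gap (T : ℝ → H →L[ℝ] H) {T' : H →L[ℝ] H} {β : ℝ}
    (hT : HasDerivAt T T' β) (hsymm : ∀ᶠ t in 𝓝 β, (T t : H →ₗ[ℝ] H).IsSymmetric)
    (hpsd : ∀ᶠ t in 𝓝 β, ∀ φ : H, 0 ≤ ⟪φ, T t φ⟫) {ψ : H} (hψ : ‖ψ‖ = 1) {Λ₀ θ : ℝ}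
    (heig : T β ψ = Λ₀ • ψ) (hθ : θ < Λ₀) (hpos : 0 < Λ₀)
    (hgap : ∀ w : H, ⟪ψ, w⟫ = 0 → ⟪w, T β w⟫ ≤ θ * ‖w‖ ^ 2) {h : ℝ} (hh : 0 < h)
    (hconv : ConvexOn ℝ (Icc (β - h) (β + h)) (fun t => Real.log ‖T t‖)) :
    HasDerivAt (fun t => Real.log ‖T t‖) (⟪ψ, T' ψ⟫ / ‖T β‖) β ∧
      (Real.log ‖T β‖ - Real.log ‖T (β - h)‖) / h ≤ ⟪ψ, T' ψ⟫ / ‖T β‖ ∧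
      ⟪ψ, T' ψ⟫ / ‖T β‖ ≤ (Real.log ‖T (β + h)‖ - Real.log ‖T β‖) / h := by
  have hψψ : ⟪ψ, ψ⟫ = 1 := by rw [real_inner_self_eq_norm_sq, hψ, one_pow]
  have hβ : ‖T β‖ = Λ₀ :=
    opNorm_eq_of_gap (T β) hsymm.self_of_nhds hpsd.self_of_nhds hψ heig hθ hgap
  have hgβ : ⟪ψ, T β ψ⟫ = Λ₀ := by rw [heig, real_inner_smul_right, hψψ, mul_one]
  have hd := hasDerivAt_log_opNorm_of_gap T hT hsymm hpsd hψ heig hθ hpos hgap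
  rw [← hβ] at hd
  have hg : HasDerivAt (fun t => ⟪ψ, T t ψ⟫) ⟪ψ, T' ψ⟫ β := hasDerivAt_inner_apply T hT ψ ψ
  have hbr := log_norm_secant_bracket T hh hconv hψ (by rw [hβ, hgβ]) (by rw [hβ]; exact hpos) hg
  exact ⟨hd, hbr.1, hbr.2⟩

/-- **Plain (non-logarithmic) version**: with `t ↦ ‖T t‖` convex on `[β - h, β + h]`, the derivative
`d/dt ‖T t‖|_β = ⟪ψ, T′ψ⟫` exists and lies between the two chords of `‖T ·‖` (`norm_secant_bracket`).
[cite: Kato1966, II-§5.4 Theorem 5.4 (5.10) (with Dudley2002 §6.3 Cor. 6.3.3 for the chords)] -/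
theorem hasDerivAt_opNorm_mem_secant_of_gap (T : ℝ → H →L[ℝ] H) {T' : H →L[ℝ] H} {β : ℝ}
    (hT : HasDerivAt T T' β) (hsymm : ∀ᶠ t in 𝓝 β, (T t : H →ₗ[ℝ] H).IsSymmetric)
    (hpsd : ∀ᶠ t in 𝓝 β, ∀ φ : H, 0 ≤ ⟪φ, T t φ⟫) {ψ : H} (hψ : ‖ψ‖ = 1) {Λ₀ θ : ℝ}
    (heig : T β ψ = Λ₀ • ψ) (hθ : θ < Λ₀)
    (hgap : ∀ w : H, ⟪ψ, w⟫ = 0 → ⟪w, T β w⟫ ≤ θ * ‖w‖ ^ 2) {h : ℝ} (hh : 0 < h)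
    (hconv : ConvexOn ℝ (Icc (β - h) (β + h)) (fun t => ‖T t‖)) :
    HasDerivAt (fun t => ‖T t‖) ⟪ψ, T' ψ⟫ β ∧
      (‖T β‖ - ‖T (β - h)‖) / h ≤ ⟪ψ, T' ψ⟫ ∧ ⟪ψ, T' ψ⟫ ≤ (‖T (β + h)‖ - ‖T β‖) / h := by
  have hψψ : ⟪ψ, ψ⟫ = 1 := by rw [real_inner_self_eq_norm_sq, hψ, one_pow]
  have hβ : ‖T β‖ = Λ₀ :=
    opNorm_eq_of_gap (T β) hsymm.self_of_nhds hpsd.self_of_nhds hψ heig hθ hgap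
  have hgβ : ⟪ψ, T β ψ⟫ = Λ₀ := by rw [heig, real_inner_smul_right, hψψ, mul_one]
  have hd := hasDerivAt_opNorm_of_gap T hT hsymm hpsd hψ heig hθ hgap
  have hg : HasDerivAt (fun t => ⟪ψ, T t ψ⟫) ⟪ψ, T' ψ⟫ β := hasDerivAt_inner_apply T hT ψ ψ
  have hbr := norm_secant_bracket T hh hconv hψ (by rw [hβ, hgβ]) hg
  exact ⟨hd, hbr.1, hbr.2⟩

end Bracket

/-! ## 4. Gap in norm form (Jentzsch / Kreĭn–Rutman shape) and positivity improving families -/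

section NormGap

variable {H : Type*} [NormedAddCommGroup H] [InnerProductSpace ℝ H]

/-- A gap in norm form on `ψ^⊥` — `‖A w‖ ≤ θ ‖w‖` for `⟪ψ, w⟫ = 0`, the conclusion of the tree's
Jentzsch theorem `IsPositivityImproving.exists_spectralGap` — implies the quadratic-form gap
`⟪w, A w⟫ ≤ θ ‖w‖²` used in this file (Cauchy–Schwarz). [cite: ReedSimonIV1978, Thm XIII.43 and
Thm XIII.44 (shape of the gap)] -/
theorem inner_apply_self_le_of_norm_apply_le (A : H →L[ℝ] H) {ψ : H} {θ : ℝ}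
    (h : ∀ w : H, ⟪ψ, w⟫ = 0 → ‖A w‖ ≤ θ * ‖w‖) (w : H) (hw : ⟪ψ, w⟫ = 0) :
    ⟪w, A w⟫ ≤ θ * ‖w‖ ^ 2 :=
  calc ⟪w, A w⟫ ≤ ‖w‖ * ‖A w‖ := real_inner_le_norm _ _
    _ ≤ ‖w‖ * (θ * ‖w‖) := mul_le_mul_of_nonneg_left (h w hw) (norm_nonneg _)
    _ = θ * ‖w‖ ^ 2 := by ring

end NormGap

section Improving

open MeasureTheory

variable {X : Type*} [MeasurableSpace X] {μ : Measure X}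

/-- **Hellmann–Feynman differentiability of the top eigenvalue for positivity improving families.**
Let `T : ℝ → (L²(μ) →L[ℝ] L²(μ))` (real `L²`) have derivative `T′` at `β` in operator norm, with `T t`
self-adjoint and positive (`⟪φ, T t φ⟫ ≥ 0`) for `t` near `β`, and let `T β` be non-zero, compact and
positivity improving. Then, with `φ` the Perron–Jentzsch vector of `T β` (unit, a.e. strictly positive,
`T β φ = ‖T β‖ φ`, spanning the top eigenspace — `IsPositivityImproving.exists_spectralGap`),
`t ↦ ‖T t‖` is differentiable at `β` with derivative `⟪φ, T′ φ⟫`. (The object-W case of the secant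
certificates: transfer operators with strictly positive continuous kernels.)
[cite: ReedSimonIV1978, Thm XIII.43 and Thm XIII.44] [cite: Kato1966, VIII-§2.3 Theorem 2.6 (2.17)
(case m = 1)] -/
theorem IsPositivityImproving.exists_hasDerivAt_opNorm (T : ℝ → Lp ℝ 2 μ →L[ℝ] Lp ℝ 2 μ)
    {T' : Lp ℝ 2 μ →L[ℝ] Lp ℝ 2 μ} {β : ℝ} (hT : HasDerivAt T T' β)
    (hsa : ∀ᶠ t in 𝓝 β, IsSelfAdjoint (T t))
    (hpsd : ∀ᶠ t in 𝓝 β, ∀ φ : Lp ℝ 2 μ, 0 ≤ ⟪φ, T t φ⟫)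
    (hImp : IsPositivityImproving (T β)) (hc : IsCompactOperator (T β)) (h0 : T β ≠ 0) :
    ∃ φ : Lp ℝ 2 μ, ‖φ‖ = 1 ∧ IsStrictlyPositiveFun φ ∧ T β φ = ‖T β‖ • φ ∧
      (∀ η : Lp ℝ 2 μ, T β η = ‖T β‖ • η → η = ⟪φ, η⟫ • φ) ∧
      HasDerivAt (fun t => ‖T t‖) ⟪φ, T' φ⟫ β := by
  obtain ⟨φ, hφ1, hφpos, hAφ, hsimple, θ, -, hθ, hgapn⟩ :=
    hImp.exists_spectralGap hsa.self_of_nhds hc h0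
  refine ⟨φ, hφ1, hφpos, hAφ, hsimple, ?_⟩
  have hsymm : ∀ᶠ t in 𝓝 β, (T t : Lp ℝ 2 μ →ₗ[ℝ] Lp ℝ 2 μ).IsSymmetric :=
    hsa.mono fun t ht => ht.isSymmetric
  exact hasDerivAt_opNorm_of_gap T hT hsymm hpsd hφ1 hAφ hθ
    (inner_apply_self_le_of_norm_apply_le (T β) hgapn)

/-- **Logarithmic form for positivity improving families**: in the setting of
`IsPositivityImproving.exists_hasDerivAt_opNorm`, `t ↦ log ‖T t‖` is differentiable at `β` with
derivative `⟪φ, T′φ⟫/‖T β‖`, `φ` the Perron–Jentzsch vector. [cite: ReedSimonIV1978, Thm XIII.43 and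
Thm XIII.44] [cite: Kato1966, VIII-§2.3 Theorem 2.6 (2.17) (case m = 1)] -/
theorem IsPositivityImproving.exists_hasDerivAt_log_opNorm (T : ℝ → Lp ℝ 2 μ →L[ℝ] Lp ℝ 2 μ)
    {T' : Lp ℝ 2 μ →L[ℝ] Lp ℝ 2 μ} {β : ℝ} (hT : HasDerivAt T T' β)
    (hsa : ∀ᶠ t in 𝓝 β, IsSelfAdjoint (T t))
    (hpsd : ∀ᶠ t in 𝓝 β, ∀ φ : Lp ℝ 2 μ, 0 ≤ ⟪φ, T t φ⟫)
    (hImp : IsPositivityImproving (T β)) (hc : IsCompactOperator (T β)) (h0 : T β ≠ 0) :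
    ∃ φ : Lp ℝ 2 μ, ‖φ‖ = 1 ∧ IsStrictlyPositiveFun φ ∧ T β φ = ‖T β‖ • φ ∧
      HasDerivAt (fun t => Real.log ‖T t‖) (⟪φ, T' φ⟫ / ‖T β‖) β := by
  obtain ⟨φ, hφ1, hφpos, hAφ, -, hd⟩ :=
    IsPositivityImproving.exists_hasDerivAt_opNorm T hT hsa hpsd hImp hc h0
  exact ⟨φ, hφ1, hφpos, hAφ, hd.log (norm_ne_zero_iff.2 h0)⟩

end Improving

/-! ## 5. Certified numerics: an approximate top vector encloses THE DERIVATIVE -/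

section Approx

variable {H : Type*} [NormedAddCommGroup H] [InnerProductSpace ℝ H]

/-- **The Hellmann–Feynman number at a certified approximate top vector encloses the derivative of the
top eigenvalue.** In the setting of `hasDerivAt_opNorm_of_gap` (gap `⟪w, T β w⟫ ≤ θ‖w‖²` on `ψ^⊥`,
`θ < λ₀`), let `v` be a unit vector with residual `‖T β v - m v‖ ≤ ρ` for a shift `m > θ`. Then
`t ↦ ‖T t‖` is differentiable at `β` and `|⟪v, T′ v⟫ - d‖T t‖/dt|_β| ≤ 2‖T′‖(δ + δ²)`, `δ = ρ/(m - θ)`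
(`sin θ(v, ψ) ≤ δ`, Davis–Kahan / Saad Thm 3.9, via `abs_inner_sub_hellmannFeynman_le`). This is the
statement behind «EXACT-HF» rows computed with a certified approximate eigenvector: the certified number
encloses the DERIVATIVE, not only the Hellmann–Feynman value. [cite: Kato1966, II-§5.4 Theorem 5.4
(5.10)] [cite: Saad1992, Ch. III Thm. 3.9 (3.24)] -/
theorem abs_inner_sub_deriv_opNorm_le_of_gap (T : ℝ → H →L[ℝ] H) {T' : H →L[ℝ] H} {β : ℝ}
    (hT : HasDerivAt T T' β) (hsymm : ∀ᶠ t in 𝓝 β, (T t : H →ₗ[ℝ] H).IsSymmetric)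
    (hpsd : ∀ᶠ t in 𝓝 β, ∀ φ : H, 0 ≤ ⟪φ, T t φ⟫) {ψ : H} (hψ : ‖ψ‖ = 1) {Λ₀ θ : ℝ}
    (heig : T β ψ = Λ₀ • ψ) (hθ : θ < Λ₀)
    (hgap : ∀ w : H, ⟪ψ, w⟫ = 0 → ⟪w, T β w⟫ ≤ θ * ‖w‖ ^ 2)
    {v : H} (hv : ‖v‖ = 1) {m ρ : ℝ} (hθm : θ < m) (hres : ‖T β v - m • v‖ ≤ ρ) :
    HasDerivAt (fun t => ‖T t‖) ⟪ψ, T' ψ⟫ β ∧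
      |⟪v, T' v⟫ - ⟪ψ, T' ψ⟫| ≤ 2 * ‖T'‖ * (ρ / (m - θ) + (ρ / (m - θ)) ^ 2) := by
  refine ⟨hasDerivAt_opNorm_of_gap T hT hsymm hpsd hψ heig hθ hgap, ?_⟩
  have hsymmβ : (T β : H →ₗ[ℝ] H).IsSymmetric := hsymm.self_of_nhds
  exact abs_inner_sub_hellmannFeynman_le (T β) T' (fun x y => hsymmβ x y) hψ heig hθm
    (fun w hw => hgap w (by rw [real_inner_comm]; exact hw)) hv hres

/-- **Logarithmic form**: with `λ₀ > 0`, `|⟪v, T′v⟫/λ₀ - d log‖T t‖/dt|_β| ≤ 2‖T′‖(δ + δ²)/λ₀`, and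
`d log ‖T t‖/dt|_β = ⟪ψ, T′ψ⟫/λ₀` exists. [cite: Kato1966, II-§5.4 Theorem 5.4 (5.10)]
[cite: Saad1992, Ch. III Thm. 3.9 (3.24)] -/
theorem abs_inner_div_sub_deriv_log_opNorm_le_of_gap (T : ℝ → H →L[ℝ] H) {T' : H →L[ℝ] H}
    {β : ℝ} (hT : HasDerivAt T T' β) (hsymm : ∀ᶠ t in 𝓝 β, (T t : H →ₗ[ℝ] H).IsSymmetric)
    (hpsd : ∀ᶠ t in 𝓝 β, ∀ φ : H, 0 ≤ ⟪φ, T t φ⟫) {ψ : H} (hψ : ‖ψ‖ = 1) {Λ₀ θ : ℝ}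
    (heig : T β ψ = Λ₀ • ψ) (hθ : θ < Λ₀) (hpos : 0 < Λ₀)
    (hgap : ∀ w : H, ⟪ψ, w⟫ = 0 → ⟪w, T β w⟫ ≤ θ * ‖w‖ ^ 2)
    {v : H} (hv : ‖v‖ = 1) {m ρ : ℝ} (hθm : θ < m) (hres : ‖T β v - m • v‖ ≤ ρ) :
    HasDerivAt (fun t => Real.log ‖T t‖) (⟪ψ, T' ψ⟫ / Λ₀) β ∧
      |⟪v, T' v⟫ / Λ₀ - ⟪ψ, T' ψ⟫ / Λ₀| ≤ 2 * ‖T'‖ * (ρ / (m - θ) + (ρ / (m - θ)) ^ 2) / Λ₀ := by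
  refine ⟨hasDerivAt_log_opNorm_of_gap T hT hsymm hpsd hψ heig hθ hpos hgap, ?_⟩
  have h := (abs_inner_sub_deriv_opNorm_le_of_gap T hT hsymm hpsd hψ heig hθ hgap hv hθm hres).2
  rw [← sub_div, abs_div, abs_of_pos hpos]
  exact div_le_div_of_nonneg_right h hpos.le

end Approx

end Literature.Analysis.OperatorTheory

end
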